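import Summits.FinalStateConjecture.FinalStateConjecture.Theorems.PhotonSphereChannelsChannelsResolveTameDevelopmentsRSubspacetimeEndTransport
import HarnessLib

/-!
# Route PhotonSphereChannels · crux `ChannelsResolveTameDevelopmentsR` (K2R-T2, stmt-FinalStateConjecture-17430) ·
# line `tame-lasalle-dock` · stub D `stub_dockReadyHull`: TRANSPORT of SILENCE to an open sub-spacetime
# (silent horizon, red-shift, cold horizon, `IsSilent`)

Companion of `…RSubspacetimeEndTransport.lean` (tameness transports to `𝓢|_U`). Here: the three horizon clauses of
`EndDatum.IsSilent` transport to the transported end `⟨E.M, E.R, E.C, fun x ↦ (⟨E.far x, hfar x⟩ : U), fun y : U ↦ E.clock y.1⟩`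
of the open sub-spacetime `𝓢|_U`, for `U ⊇ E.doc ∪ range E.far ∪ E.horizon`:

* §1 `contMDiffAt_section_restrict_iff`, `contMDiffOn_section_restrict` — a vector field restricted to `U` is a `C^n`
  section of `TU` where it is one of `T𝓢` (same trivialisations, `trivializationAt_tangentSpace_opens_snd`);
  `leviCivita_restrict_apply` — `∇^{g|_U}(V|_U) = (∇^g V)|_U` (naturality under the inclusion,
  `leviCivita_comap_mpullback_apply`, `restrict_eq_comap`); `mvfderiv_clock_restrict` — `d(t ∘ ι) = dt`;
  `isMIntegralCurveOn_subtypeVal_comp` — integral curves of `V|_U` are integral curves of `V`;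
* §2 `isSilentHorizon_transport`, `isRedShifted_transport`, `isColdHorizon_transport`, `isSilent_transport` (registered
  sub-goal) — with the SAME generator field (restricted), the same `κ`, the same clock rate, on `horizon = ι⁻¹ E.horizon`
  (`horizon_transport`).

No route item is restated. References: O'Neill 1983, Ch. 1 pp. 3–7, Ch. 3 Prop. 3.59 [ONeill1983]; Wald 1984, §12.5
[Wald1984]; Dafermos–Rodnianski 2008, §7.1 and §3.3.2 [DafermosRodnianski2008]; Chruściel–Delay–Galloway–Howard 2001, Thm 1.1
[ChruscielEtAl2001].
-/

noncomputable section

set_option maxSynthPendingDepth 3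
set_option linter.dupNamespace false

open Set Filter Function TopologicalSpace Manifold Bundle VectorField
open scoped Topology Manifold ContDiff ENNReal NNReal

namespace Summit.FinalStateConjecture.FinalStateConjecture.Theorems.TameLaSalle

open Literature.Geometry.Lorentzian
open Summit.FinalStateConjecture.FinalStateConjecture.Theorems.TameHull

/-! ### §1 Sections, connection, clock rate and integral curves in an open sub-spacetime -/

section Opens

variable {EM : Type*} [NormedAddCommGroup EM] [NormedSpace ℝ EM] {HM : Type*} [TopologicalSpace HM]
  {IM : ModelWithCorners ℝ EM HM} {M : Type*} [TopologicalSpace M] [ChartedSpace HM M] [IsManifold IM ∞ M]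
  {n : ℕ∞ω}

/-- **A vector field restricted to an open submanifold `U` is `C^n` at `y` (as a section of `TU`) iff it is `C^n` at
`↑y` (as a section of `TM`)**: the preferred trivialisations of `TU` and `TM` have the same fibre coordinate
(`trivializationAt_tangentSpace_opens_snd`), and `x ↦ f ↑x` is `C^n` at `y` iff `f` is at `↑y`
(`contMDiffAt_subtype_iff`). O'Neill 1983, Ch. 1, Prop. 1.32 (1) and p. 7. [cite: ONeill1983, Ch. 1, p. 7] -/
theorem contMDiffAt_section_restrict_iff (U : Opens M) (V : Π x : M, TangentSpace IM x) (y : U) :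
    ContMDiffAt IM IM.tangent n (fun x : U ↦ (TotalSpace.mk' EM x (V x.1) : TangentBundle IM U)) y ↔
      ContMDiffAt IM IM.tangent n (fun x : M ↦ (TotalSpace.mk' EM x (V x) : TangentBundle IM M)) y.1 := by
  -- adapted from `TimeOrientation.contMDiff_restrict_holds` (LorentzianMetricProofs.lean)
  rw [Bundle.contMDiffAt_section, Bundle.contMDiffAt_section]
  have h : (fun x : U ↦ ((trivializationAt EM (TangentSpace IM) y)
      (TotalSpace.mk' EM x (V x.1) : TangentBundle IM U)).2) =
      fun x : U ↦ ((trivializationAt EM (TangentSpace IM) (y : M))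
        (TotalSpace.mk' EM (x : M) (V x.1) : TangentBundle IM M)).2 :=
    funext fun x ↦ trivializationAt_tangentSpace_opens_snd (E := EM) U y x (V x.1)
  rw [h]
  exact contMDiffAt_subtype_iff (f := fun x : M ↦ ((trivializationAt EM (TangentSpace IM) (y : M))
    (TotalSpace.mk' EM x (V x) : TangentBundle IM M)).2)

/-- A vector field which is `C^n` on an open set `𝒩` (as a section of `TM`) restricts to a `C^n` section of `TU` on
`ι⁻¹ 𝒩`. O'Neill 1983, Ch. 1, Prop. 1.32 (1). [cite: ONeill1983, Ch. 1, Prop. 1.32] -/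
theorem contMDiffOn_section_restrict (U : Opens M) {V : Π x : M, TangentSpace IM x} {𝒩 : Set M} (h𝒩 : IsOpen 𝒩)
    (hV : ContMDiffOn IM IM.tangent n (fun x : M ↦ (TotalSpace.mk' EM x (V x) : TangentBundle IM M)) 𝒩) :
    ContMDiffOn IM IM.tangent n (fun x : U ↦ (TotalSpace.mk' EM x (V x.1) : TangentBundle IM U))
      (Subtype.val ⁻¹' 𝒩) := fun y hy ↦
  ((contMDiffAt_section_restrict_iff U V y).2 (hV.contMDiffAt (h𝒩.mem_nhds hy))).contMDiffWithinAt

omit [IsManifold IM ∞ M] in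
/-- `dι(w) = w` for the inclusion `ι` of an open submanifold. [folklore] -/
theorem mfderiv_subtypeVal_apply' (U : Opens M) (y : U) (w : TangentSpace IM y) :
    mfderiv IM IM (Subtype.val : U → M) y w = w := by
  -- adapted from `mfderiv_subtypeVal_apply` (DocStationarySpacetime.lean)
  rw [mfderiv_subtypeVal]; rfl

omit [IsManifold IM ∞ M] in
/-- `(dι)⁻¹(w) = w` for the inclusion `ι` of an open submanifold. [folklore] -/
theorem inverse_mfderiv_subtypeVal_apply' (U : Opens M) (y : U) (w : TangentSpace IM y.1) :
    (mfderiv IM IM (Subtype.val : U → M) y).inverse w = w := by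
  -- adapted from `inverse_mfderiv_subtypeVal_apply` (DocStationarySpacetime.lean)
  have key : (mfderiv IM IM (Subtype.val : U → M) y : EM →L[ℝ] EM) = ContinuousLinearMap.id ℝ EM :=
    mfderiv_subtypeVal y
  change ContinuousLinearMap.inverse (mfderiv IM IM (Subtype.val : U → M) y : EM →L[ℝ] EM) w = w
  rw [key]
  exact congrArg (fun A : EM →L[ℝ] EM ↦ A w) (ContinuousLinearMap.inverse_id (R := ℝ) (M := EM))

omit [IsManifold IM ∞ M] in
/-- The pullback of a vector field along the inclusion of an open submanifold is its restriction. [folklore] -/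
theorem mpullback_subtypeVal' (U : Opens M) (V : Π x : M, TangentSpace IM x) :
    mpullback IM IM (Subtype.val : U → M) V = fun y : U ↦ (V y.1 : TangentSpace IM y) := by
  -- adapted from `mpullback_subtypeVal` (DocStationarySpacetime.lean)
  funext y
  rw [mpullback_apply]
  exact inverse_mfderiv_subtypeVal_apply' U y (V y.1)

omit [IsManifold IM ∞ M] in
/-- **The integral curves of `V|_U` are integral curves of `V`** (`dι = id`). Lee 2013, Prop. 3.9. [folklore] -/
theorem isMIntegralCurveOn_subtypeVal_comp (U : Opens M) {V : Π x : M, TangentSpace IM x} {γ : ℝ → U} {s : Set ℝ}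
    (h : IsMIntegralCurveOn (I := IM) γ (fun y : U ↦ (V y.1 : TangentSpace IM y)) s) :
    IsMIntegralCurveOn (I := IM) (Subtype.val ∘ γ) V s := fun t ht ↦ by
  have h1 := (hasMFDerivAt_subtypeVal (I' := IM) (W := U) (γ t)).comp_hasMFDerivWithinAt t (h t ht)
  exact h1.congr_mfderiv (ContinuousLinearMap.ext fun _ ↦ rfl)

/-- Equal metrics have equal Levi-Civita connections (whatever the proofs of the standing hypothesis). [folklore] -/
theorem leviCivita_congr_metric''
    {g₁ g₂ : PseudoRiemannianMetric IM n EM (TangentSpace IM : M → Type _)} (h : g₁ = g₂)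
    [i₁ : g₁.HasLeviCivita] [i₂ : g₂.HasLeviCivita] (X : Π x : M, TangentSpace IM x) (x : M) :
    g₁.leviCivita X x = g₂.leviCivita X x := by
  subst h; rfl

end Opens

variable {𝓢 : Spacetime.{0} 4} {U : Opens 𝓢.carrier} (hU : IsConnected (U : Set 𝓢.carrier))

/-- **The connection restricts: `∇^{g|_U}_v (V|_U) (y) = ∇^g_v V (↑y)`** for a field differentiable at `↑y` (the restricted
metric is the pullback along the inclusion, `restrict_eq_comap`; naturality of the Levi-Civita connection,
`leviCivita_comap_mpullback_apply`; `dι = id`). O'Neill 1983, Ch. 3, Prop. 3.59. [cite: ONeill1983, Ch. 3, Prop. 3.59] -/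
theorem leviCivita_restrict_apply [𝓢.metric.HasLeviCivita]
    [iR : (𝓢.restrict PseudoRiemannianMetric.contMDiff_restrict_holds 𝓢.timeOrientation.contMDiff_restrict_holds
      U hU).metric.HasLeviCivita]
    {V : Π x : 𝓢.carrier, TangentSpace (𝓡 4) x} (y : U)
    (hV : MDifferentiableAt (𝓡 4) (𝓡 4).tangent
      (fun x ↦ (TotalSpace.mk' E4 x (V x) : TangentBundle (𝓡 4) 𝓢.carrier)) y.1) (v : E4) :
    (𝓢.restrict PseudoRiemannianMetric.contMDiff_restrict_holds 𝓢.timeOrientation.contMDiff_restrict_holds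
        U hU).metric.leviCivita (fun y : U ↦ (V y.1 : TangentSpace (𝓡 4) y)) y v =
      𝓢.metric.leviCivita V y.1 v := by
  -- adapted from `leviCivita_docKilling_apply` (DocStationarySpacetime.lean)
  set gc := 𝓢.metric.toPseudoRiemannianMetric.comap PseudoRiemannianMetric.contMDiff_pullbackBilin_holds
    (Subtype.val : U → 𝓢.carrier) contMDiff_subtype_val (injective_mfderiv_subtypeVal U) rfl with hgc_def
  haveI hgcLC : gc.HasLeviCivita := gc.hasLeviCivita
  have hgc : (𝓢.restrict PseudoRiemannianMetric.contMDiff_restrict_holds 𝓢.timeOrientation.contMDiff_restrict_holds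
      U hU).metric.toPseudoRiemannianMetric = gc :=
    PseudoRiemannianMetric.restrict_eq_comap 𝓢.metric.toPseudoRiemannianMetric U
  have key := 𝓢.metric.toPseudoRiemannianMetric.leviCivita_comap_mpullback_apply
    PseudoRiemannianMetric.contMDiff_pullbackBilin_holds contMDiff_subtype_val (injective_mfderiv_subtypeVal U) rfl hV v
  rw [mpullback_subtypeVal', inverse_mfderiv_subtypeVal_apply', mfderiv_subtypeVal_apply'] at key
  exact (congrArg (fun A ↦ A v) (leviCivita_congr_metric'' hgc (i₁ := iR) (i₂ := hgcLC) _ y)).trans key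

/-- **The clock rate restricts: `d(t ∘ ι)_y (w) = dt_{↑y} (w)`** for `t` differentiable at `↑y`. [folklore] -/
theorem mvfderiv_clock_restrict {t : 𝓢.carrier → ℝ} (y : U) (ht : MDifferentiableAt (𝓡 4) 𝓘(ℝ, ℝ) t y.1)
    (w : E4) : mvfderiv (𝓡 4) (fun y : U ↦ t y.1) y w = mvfderiv (𝓡 4) t y.1 w := by
  have h := PseudoRiemannianMetric.mvfderiv_comp_apply (I := 𝓡 4) (I' := 𝓡 4)
    (Φ := (Subtype.val : U → 𝓢.carrier)) ht
    (hasMFDerivAt_subtypeVal (I' := 𝓡 4) y).mdifferentiableAt w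
  rw [mfderiv_subtypeVal_apply'] at h
  exact h

/-! ### §2 Silence transports -/

variable (E : EndDatum 𝓢) (hfar : ∀ x, E.far x ∈ U)

/-- **A silent horizon transports to `𝓢|_U ⊇ E.doc ∪ range E.far`**: the restricted generator field is `C^∞` on `ι⁻¹ 𝒩`
(`contMDiffOn_section_restrict`), null, future-directed, clock-normalised (`mvfderiv_clock_restrict`), non-expanding and
shear-free (`leviCivita_restrict_apply`) on `horizon = ι⁻¹ E.horizon` (`horizon_transport`), and its integral curves are
integral curves of `L` (`isMIntegralCurveOn_subtypeVal_comp`). Wald 1984, §12.5. [cite: Wald1984, §12.5] -/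
theorem isSilentHorizon_transport (hdoc : E.doc ⊆ U) (hclock : ContMDiff (𝓡 4) 𝓘(ℝ, ℝ) ∞ E.clock)
    (h : E.IsSilentHorizon) :
    EndDatum.IsSilentHorizon (⟨E.M, E.R, E.C, fun x ↦ (⟨E.far x, hfar x⟩ : U), fun y : U ↦ E.clock y.1⟩ : EndDatum
      (𝓢.restrict PseudoRiemannianMetric.contMDiff_restrict_holds 𝓢.timeOrientation.contMDiff_restrict_holds U hU)) := by
  intro iR
  haveI : 𝓢.metric.HasLeviCivita := 𝓢.metric.toPseudoRiemannianMetric.hasLeviCivita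
  obtain ⟨L, ⟨𝒩, h𝒩, hH𝒩, hLreg⟩, hpt, hinv⟩ := h
  have hhor := horizon_transport hU E hfar hdoc
  refine ⟨fun y : U ↦ (L y.1 : TangentSpace (𝓡 4) y), ⟨Subtype.val ⁻¹' 𝒩, h𝒩.preimage continuous_subtype_val,
    ?_, contMDiffOn_section_restrict U h𝒩 hLreg⟩, fun p hp ↦ ?_, fun γ a b hab hγ hγa ↦ ?_⟩
  · rw [hhor]; exact preimage_mono hH𝒩
  · rw [hhor] at hp
    obtain ⟨hnull, hfut, hclk, hχ⟩ := hpt p.1 hp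
    have hLd : MDifferentiableAt (𝓡 4) (𝓡 4).tangent
        (fun x ↦ (TotalSpace.mk' E4 x (L x) : TangentBundle (𝓡 4) 𝓢.carrier)) p.1 :=
      (hLreg.contMDiffAt (h𝒩.mem_nhds (hH𝒩 hp))).mdifferentiableAt (by simp)
    refine ⟨hnull, hfut, ?_, fun v w hv hw ↦ ?_⟩
    · exact (mvfderiv_clock_restrict (t := E.clock) p (hclock.mdifferentiableAt (by simp)) (L p.1)).trans hclk
    · change 𝓢.metric.val p.1 ((𝓢.restrict PseudoRiemannianMetric.contMDiff_restrict_holds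
        𝓢.timeOrientation.contMDiff_restrict_holds U hU).metric.leviCivita
          (fun y : U ↦ (L y.1 : TangentSpace (𝓡 4) y)) p v) w = 0
      rw [leviCivita_restrict_apply hU p hLd]
      exact hχ v w hv hw
  · rw [hhor] at hγa ⊢
    exact hinv (Subtype.val ∘ γ) a b hab (isMIntegralCurveOn_subtypeVal_comp U hγ) hγa

/-- **A red-shifted horizon transports** (same generator field and surface gravity function, restricted).
Dafermos–Rodnianski 2008, §7.1. [cite: DafermosRodnianski2008, §7.1 Thm. 7.1] -/
theorem isRedShifted_transport (hdoc : E.doc ⊆ U) (hclock : ContMDiff (𝓡 4) 𝓘(ℝ, ℝ) ∞ E.clock) {κ₀ : ℝ}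
    (h : E.IsRedShifted κ₀) :
    EndDatum.IsRedShifted (⟨E.M, E.R, E.C, fun x ↦ (⟨E.far x, hfar x⟩ : U), fun y : U ↦ E.clock y.1⟩ : EndDatum
      (𝓢.restrict PseudoRiemannianMetric.contMDiff_restrict_holds 𝓢.timeOrientation.contMDiff_restrict_holds U hU)) κ₀ := by
  intro iR
  haveI : 𝓢.metric.HasLeviCivita := 𝓢.metric.toPseudoRiemannianMetric.hasLeviCivita
  obtain ⟨L, κ, ⟨𝒩, h𝒩, hH𝒩, hLreg⟩, hpt, hinv⟩ := h
  have hhor := horizon_transport hU E hfar hdoc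
  refine ⟨fun y : U ↦ (L y.1 : TangentSpace (𝓡 4) y), fun y ↦ κ y.1, ⟨Subtype.val ⁻¹' 𝒩,
    h𝒩.preimage continuous_subtype_val, ?_, contMDiffOn_section_restrict U h𝒩 hLreg⟩, fun p hp ↦ ?_,
    fun γ a b hab hγ hγa ↦ ?_⟩
  · rw [hhor]; exact preimage_mono hH𝒩
  · change p ∈ EndDatum.horizon _ at hp
    rw [hhor] at hp
    obtain ⟨hnull, hfut, hclk, hgeo, hκ⟩ := hpt p.1 hp
    have hLd : MDifferentiableAt (𝓡 4) (𝓡 4).tangent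
        (fun x ↦ (TotalSpace.mk' E4 x (L x) : TangentBundle (𝓡 4) 𝓢.carrier)) p.1 :=
      (hLreg.contMDiffAt (h𝒩.mem_nhds (hH𝒩 hp))).mdifferentiableAt (by simp)
    refine ⟨hnull, hfut, ?_, ?_, hκ⟩
    · exact (mvfderiv_clock_restrict (t := E.clock) p (hclock.mdifferentiableAt (by simp)) (L p.1)).trans hclk
    · have key := leviCivita_restrict_apply hU (V := L) p hLd (L p.1)
      exact key.trans hgeo
  · change γ a ∈ EndDatum.horizon _ at hγa
    rw [hhor] at hγa ⊢
    exact hinv (Subtype.val ∘ γ) a b hab (isMIntegralCurveOn_subtypeVal_comp U hγ) hγa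

/-- **A cold horizon transports to `𝓢|_U ⊇ E.doc ∪ range E.far ∪ E.horizon`** (nonemptiness needs the horizon inside `U`;
same affine generator field and clock-rate bounds). Dafermos–Rodnianski 2008, §3.3.2. [cite: DafermosRodnianski2008, §3.3.2 Prop. 3.3.1] -/
theorem isColdHorizon_transport (hdoc : E.doc ⊆ U) (hhorU : E.horizon ⊆ U)
    (hclock : ContMDiff (𝓡 4) 𝓘(ℝ, ℝ) ∞ E.clock) (h : E.IsColdHorizon) :
    EndDatum.IsColdHorizon (⟨E.M, E.R, E.C, fun x ↦ (⟨E.far x, hfar x⟩ : U), fun y : U ↦ E.clock y.1⟩ : EndDatum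
      (𝓢.restrict PseudoRiemannianMetric.contMDiff_restrict_holds 𝓢.timeOrientation.contMDiff_restrict_holds U hU)) := by
  obtain ⟨⟨h₀, hh₀⟩, h⟩ := h
  have hhor := horizon_transport hU E hfar hdoc
  refine ⟨⟨⟨h₀, hhorU hh₀⟩, ?_⟩, fun {iR} ↦ ?_⟩
  · rw [hhor]; exact hh₀
  · haveI : 𝓢.metric.HasLeviCivita := 𝓢.metric.toPseudoRiemannianMetric.hasLeviCivita
    obtain ⟨L, c, hc, ⟨𝒩, h𝒩, hH𝒩, hLreg⟩, hpt, hinv⟩ := h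
    refine ⟨fun y : U ↦ (L y.1 : TangentSpace (𝓡 4) y), c, hc, ⟨Subtype.val ⁻¹' 𝒩,
      h𝒩.preimage continuous_subtype_val, ?_, contMDiffOn_section_restrict U h𝒩 hLreg⟩, fun p hp ↦ ?_,
      fun γ a b hab hγ hγa ↦ ?_⟩
    · rw [hhor]; exact preimage_mono hH𝒩
    · rw [hhor] at hp
      obtain ⟨hnull, hfut, hgeo, hlow, hup⟩ := hpt p.1 hp
      have hLd : MDifferentiableAt (𝓡 4) (𝓡 4).tangent
          (fun x ↦ (TotalSpace.mk' E4 x (L x) : TangentBundle (𝓡 4) 𝓢.carrier)) p.1 :=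
        (hLreg.contMDiffAt (h𝒩.mem_nhds (hH𝒩 hp))).mdifferentiableAt (by simp)
      refine ⟨hnull, hfut, (leviCivita_restrict_apply hU (V := L) p hLd (L p.1)).trans hgeo, ?_, ?_⟩
      · exact hlow.trans_eq
          (mvfderiv_clock_restrict (t := E.clock) p (hclock.mdifferentiableAt (by simp)) (L p.1)).symm
      · exact (mvfderiv_clock_restrict (t := E.clock) p (hclock.mdifferentiableAt (by simp)) (L p.1)).trans_le hup
    · rw [hhor] at hγa ⊢
      exact hinv (Subtype.val ∘ γ) a b hab (isMIntegralCurveOn_subtypeVal_comp U hγ) hγa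

/-- **Silence transports to an open sub-spacetime containing the d.o.c., the far cylinder and the horizon (registered sub-goal
`isSilent_transport` of stmt-FinalStateConjecture-17430).** If `E` is a silent end of `𝓢` with smooth clock (e.g. `E` tame), and
`U ⊇ E.doc ∪ range E.far ∪ E.horizon` is a connected open set, then the transported end of `𝓢|_U` — same far chart and clock —
is silent: non-radiating (a property of the far deviation, `isNonRadiating_transport_iff`), silent horizon, and red-shifted or
cold with the same constants. This is the `E'.IsSilent` clause of the sub-spacetime representative of stub D.
[cite: ChruscielEtAl2001, Thm 1.1] -/
theorem isSilent_transport : ∀ {𝓢 : Spacetime.{0} 4} {U : Opens 𝓢.carrier} (hU : IsConnected (U : Set 𝓢.carrier)) (E : EndDatum 𝓢) (hfar : ∀ x, E.far x ∈ U), E.doc ⊆ U → E.horizon ⊆ U → ContMDiff (𝓡 4) 𝓘(ℝ, ℝ) ∞ E.clock → E.IsSilent → EndDatum.IsSilent (⟨E.M, E.R, E.C, fun x ↦ (⟨E.far x, hfar x⟩ : U), fun y : U ↦ E.clock y.1⟩ : EndDatum (𝓢.restrict PseudoRiemannianMetric.contMDiff_restrict_holds 𝓢.timeOrientation.contMDiff_restrict_holds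 U hU)) := by
  intro 𝓢 U hU E hfar hdoc hhorU hclock h
  obtain ⟨hnr, hsh, hrc⟩ := h
  refine ⟨(isNonRadiating_transport_iff hU E hfar).2 hnr, isSilentHorizon_transport hU E hfar hdoc hclock hsh, ?_⟩
  rcases hrc with ⟨κ₀, hκ₀, hred⟩ | hcold
  · exact Or.inl ⟨κ₀, hκ₀, isRedShifted_transport hU E hfar hdoc hclock hred⟩
  · exact Or.inr (isColdHorizon_transport hU E hfar hdoc hhorU hclock hcold)

end Summit.FinalStateConjecture.FinalStateConjecture.Theorems.TameLaSalle

end
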